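import Summits.BirchSwinnertonDyer.BirchSwinnertonDyer.Theorems.EisensteinDepletionAtTwoStarOptBSFMidWalkCore
import Summits.BirchSwinnertonDyer.BirchSwinnertonDyer.Theorems.EisensteinDepletionAtTwoStarOptBNSFStubIsogenyFactor
import Summits.BirchSwinnertonDyer.BirchSwinnertonDyer.Theorems.EisensteinDepletionAtTwoStarOptBNSFStubOddIsoArch
import Summits.BirchSwinnertonDyer.BirchSwinnertonDyer.Theorems.EisensteinDepletionAtTwoStarOptBNSFStubOddIsoTwoAdic
import Literature.NumberTheory.EllipticCurves.EichlerShimuraConstruction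
import Literature.NumberTheory.EllipticCurves.IsogenyFrobeniusTraceHoldsProofs
import Literature.NumberTheory.EllipticCurves.ModularSymbols
import HarnessLib

/-!
# Line `star` on crux E1M (stmt-BirchSwinnertonDyer-20341): THE MID WALK (door) — (T2) «no MID-pointed optimal curve in a habitat class»
# reduced, print-free, to (T2′) «the MID point's 2-isogenous partner is not a centre»

Lead star-p1 GEN 17.  Part 2 of 2 (part 1: Theorems/…StarOptBSFMidWalkCore, the walk).  The registered research stub `stub_optimalNotMidPointed` (T2) of
Lines/star.lean says: in a habitat class (`W` globally minimal, good ordinary at 2, UNIQUE rational 2-torsion abscissa of Greenberg type A xor B) at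
squarefree level `N ≠ 15`, the lattice-optimal `W₀` has no rational 2-torsion abscissa that is RAMIFIED at 2 AND ODD (a «MID point»).  By the MID walk
(`MidWalk.not_typeAB_of_midPoint`, no optimality used) a MID point `m` on ANY curve of the class of a habitat curve forces the 2-isogenous partner
`W₀/⟨P_m⟩` to be a CENTRE, i.e. `(b₄ + m b₂ + 6m²)/2 ∈ ℚ²`.  Hence (T2) follows from the sharper
  (T2′) «in a habitat class at squarefree `N ≠ 15`, a ramified-and-odd rational abscissa `m` of the lattice-optimal `W₀` has `(b₄ + m b₂ + 6m²)/2 ∉ ℚ²»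
(`optimalNotMidPointed_of_partnerNotCentre`; the isogeny `W₀ ~ W` is factored as 2-power `W₀ → V` times odd `W → V` by `stub_isogenyFactor`, and the odd
isogeny transports the habitat point by `stub_oddIso{Unique,TwoAdic,Arch}`).  Under the node law (N256, Theorems/…StarOptBSFSigmaNode) (T2′) is a finite
Diophantine statement: with `α = b₂ + 12m ≡ 2 (mod 4)`, `β = (α² − 256)/32` in the `+256` branch, `β/2 ∈ ℚ² ⟺ α = ±34`, and MID (`α < −16`) leaves
`α = −34` — the `15a1` shape (`N = 15`, excluded); the `−256` branch is the Neumann–Setzer shape (prime level in all data, `17a` the only centre case).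

CONDITIONAL on (T2′) (stated inline); fact-free otherwise; no `sorry`, no new definition; nothing here reads `r_an`; StarOptB / E1M / BSD are NOT proved.
-/

set_option linter.dupNamespace false
set_option autoImplicit false

noncomputable section

open scoped Classical

open WeierstrassCurve Literature.NumberTheory.EllipticCurves Literature.NumberTheory.EllipticCurves.Greenberg1999
open Literature.NumberTheory.EllipticCurves.ModularForms

namespace Summit.BirchSwinnertonDyer.BirchSwinnertonDyer.Theorems.DepletionAtTwo.MidWalk

/-! ### §4 (T2) from (T2′) -/

/-- **(T2) «no MID-pointed optimal curve in a habitat class» — the registered stub `stub_optimalNotMidPointed` of Lines/star.lean, VERBATIM — from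
(T2′) «the MID point's partner is not a centre»** (stated inline with the same binders and the conclusion `(b₄ + x₀ b₂ + 6x₀²)/2 ∉ ℚ²`), PRINT-FREE.
Factor `W₀ ~ W` as a 2-power isogeny `W₀ → V` and an odd isogeny `W → V` (`stub_isogenyFactor`); the odd isogeny transports the habitat point of `W` to a
unique point of `V` of the same type (`stub_oddIsoUnique`, `stub_oddIsoTwoAdic`, `stub_oddIsoArch`); `not_typeAB_of_midPoint`.
CONDITIONAL on (T2′). [cite: GreenbergLNM1716, §5 Props. 5.13–5.14 (pp. 120–121)] [cite: SilvermanAEC2009, III.4.12 and III.6.1] -/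
theorem optimalNotMidPointed_of_partnerNotCentre
    (hT2' : ∀ (W : WeierstrassCurve ℚ) [W.IsElliptic] [W.IsGloballyMinimal] (x : ℚ), IsOrdinaryAt W 2 →
      HasUniqueRationalTwoTorsionX W x →
      ((TwoTorsionRamifiedAtTwo x ∧ ¬ TwoTorsionOdd W x) ∨ (TwoTorsionOdd W x ∧ ¬ TwoTorsionRamifiedAtTwo x)) →
      W.conductorNorm ℤ ≠ 15 → Squarefree (W.conductorNorm ℤ) →
      ∀ ⦃N : ℕ⦄ [NeZero N] (f : CuspForm (CongruenceSubgroup.Gamma0 N) 2),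
      IsNewformOf W f →
      ∀ (W₀ : WeierstrassCurve ℚ) [W₀.IsElliptic] [W₀.IsGloballyMinimal],
      IsNewformOf W₀ f →
      ∀ (L₀ : PeriodPair), IsNeronLatticeOf (W₀.baseChange ℂ) L₀ → ∀ (q : ℚ), q ≠ 0 →
      (∀ z ∈ periodLattice f, (q : ℂ) * z ∈ L₀.lattice) →
      (∀ z ∈ L₀.lattice, ∃ w ∈ periodLattice f, z = (q : ℂ) * w) →
      ∀ (x₀ : ℚ), HasRationalTwoTorsionX W₀ x₀ → TwoTorsionRamifiedAtTwo x₀ → TwoTorsionOdd W₀ x₀ →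
      ¬ IsSquare ((W₀.b₄ + x₀ * W₀.b₂ + 6 * x₀ ^ 2) / 2)) :
    ∀ (W : WeierstrassCurve ℚ) [W.IsElliptic] [W.IsGloballyMinimal] (x : ℚ), IsOrdinaryAt W 2 →
      HasUniqueRationalTwoTorsionX W x →
      ((TwoTorsionRamifiedAtTwo x ∧ ¬ TwoTorsionOdd W x) ∨ (TwoTorsionOdd W x ∧ ¬ TwoTorsionRamifiedAtTwo x)) →
      W.conductorNorm ℤ ≠ 15 → Squarefree (W.conductorNorm ℤ) →
      ∀ ⦃N : ℕ⦄ [NeZero N] (f : CuspForm (CongruenceSubgroup.Gamma0 N) 2),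
      IsNewformOf W f →
      ∀ (W₀ : WeierstrassCurve ℚ) [W₀.IsElliptic] [W₀.IsGloballyMinimal],
      IsNewformOf W₀ f →
      ∀ (L₀ : PeriodPair), IsNeronLatticeOf (W₀.baseChange ℂ) L₀ → ∀ (q : ℚ), q ≠ 0 →
      (∀ z ∈ periodLattice f, (q : ℂ) * z ∈ L₀.lattice) →
      (∀ z ∈ L₀.lattice, ∃ w ∈ periodLattice f, z = (q : ℂ) * w) →
      ∀ (x₀ : ℚ), HasRationalTwoTorsionX W₀ x₀ → TwoTorsionRamifiedAtTwo x₀ → ¬ TwoTorsionOdd W₀ x₀ := by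
  intro W _ _ x hord hux htype h15 hsf N _ f hW W₀ _ _ hW₀ L₀ hL₀ q hq hin hout x₀ hx₀ hR₀ hO₀
  have hnsq := hT2' W x hord hux htype h15 hsf f hW W₀ hW₀ L₀ hL₀ q hq hin hout x₀ hx₀ hR₀ hO₀
  have hiso : WeierstrassCurve.IsIsogenous W W₀ :=
    IsNewformOf.isIsogenous WeierstrassCurve.isIsogenous_iff_frobeniusTrace_eq_holds hW hW₀
  have hiso' : WeierstrassCurve.IsIsogenous W₀ W := WeierstrassCurve.IsIsogenous.symm_of_charZero hiso
  have hord₀ : IsOrdinaryAt W₀ 2 := IsogenyMuShift.isOrdinaryAt_of_isIsogenous hiso hord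
  obtain ⟨V, hVell, hVmin, φ₁, ψ, hk, hodd⟩ :=
    Summit.BirchSwinnertonDyer.BirchSwinnertonDyer.Theorems.EisensteinDepletionAtTwoStarOptBNSFStubIsogenyFactor.stub_isogenyFactor W₀ W hiso'
  haveI := hVell
  haveI := hVmin
  -- the habitat point of `W` transported to `V` along the odd isogeny `ψ : W → V`
  obtain ⟨xV, huV⟩ := NsfStubs.stub_oddIsoUnique W V ψ hodd x hux
  have hRiff := NsfStubs.stub_oddIsoTwoAdic W V ψ hodd hord x xV hux huV
  have hOiff := NsfStubs.stub_oddIsoArch W V ψ hodd x xV hux huV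
  have htypeV : (TwoTorsionRamifiedAtTwo xV ∧ ¬ TwoTorsionOdd V xV) ∨ (TwoTorsionOdd V xV ∧ ¬ TwoTorsionRamifiedAtTwo xV) := by
    rcases htype with ⟨hR, hnO⟩ | ⟨hO, hnR⟩
    · exact Or.inl ⟨hRiff.mp hR, fun h ↦ hnO (hOiff.mpr h)⟩
    · exact Or.inr ⟨hOiff.mp hO, fun h ↦ hnR (hRiff.mpr h)⟩
  exact not_typeAB_of_midPoint W₀ hord₀ hx₀ hR₀ hO₀ hnsq V φ₁ hk huV htypeV

end Summit.BirchSwinnertonDyer.BirchSwinnertonDyer.Theorems.DepletionAtTwo.MidWalk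

end
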